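import Literature.Combinatorics.Optimization.TracialDesigns
import Literature.Analysis.Calculus.IteratedDifferenceBound
import Mathlib.Algebra.Group.ForwardDiff
import Mathlib.RingTheory.Polynomial.Pochhammer
import Mathlib.Data.Nat.Choose.Bounds
import Mathlib.Analysis.Calculus.IteratedDeriv.Defs
import HarnessLib

/-!
# The extrapolation error of an exact design: Newton's remainder and the Lebesgue inequality

`TracialDesigns.lean` defines an *exact extrapolation design* `IsExactDesign n t T D B C w`: weights
`w_c` on odd levels `3 ≤ c ≤ T` with `Σ_{c ∈ C} w_c p(c) = -p(0)` for every real polynomial `p` of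
degree `≤ D` and total variation `Σ_c |w_c| ≤ B`. Everything the cell `pnp-psdrank` prices with such a
design is a *level profile* `φ : ℕ → ℝ` (a shell average of some statistic of the cut), and the priced
quantity is the *design error* `Σ_{c ∈ C} w_c φ(c) + φ(0)` — zero for polynomial profiles of degree
`≤ D`, and in general controlled by how far `φ` is from such a polynomial on `{0} ∪ C ⊆ [0, T]`.
This file records the two classical estimates, PROVED (0 facts, 0 sorry):

* §1 **Newton's forward-difference formula with remainder** (the discrete Taylor formula)
  [Agarwal, *Difference Equations and Inequalities*, Thm. 1.8.5, (1.8.6), base point `a = 0`,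
  `n = D + 1`]: with `R_D(m)φ := φ(m) - Σ_{k ≤ D} C(m,k) (Δ^k φ)(0)` (`newtonRem`),
  `R_D(m)φ = Σ_{j < m} C(m-1-j, D) (Δ^{D+1} φ)(j)` (`newtonRem_eq_sum`, the kernel
  `(k-ℓ-1)^{(n-1)}/(n-1)!` of (1.8.6)), hence [Agarwal, Remark 1.8.1, (1.8.8)]
  `|R_D(m)φ| ≤ C(m, D+1) · max_{j + D + 1 ≤ m} |Δ^{D+1} φ(j)|` (`abs_newtonRem_le`) and
  `R_D(m)φ ≥ 0` when `Δ^{D+1}φ ≥ 0` on `[0, m-D-1]` (`newtonRem_nonneg`); the Newton polynomial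
  `Σ_{k ≤ D} (Δ^kφ)(0) C(X,k)` as a real polynomial of degree `≤ D` (`newtonPoly`,
  `newtonPoly_eval_natCast`, `natDegree_newtonPoly_le`).
* §2 **The Lebesgue inequality for an exact rule** [Rivlin, *The Chebyshev Polynomials*, Sect. 1.3,
  (1.32)–(1.34); p. 121]: for weights exact at `0` in degree `≤ D`,
  `Σ_c w_c φ(c) + φ(0) = Σ_c w_c (φ - p)(c) + (φ - p)(0)` for EVERY polynomial `p` of degree `≤ D`
  (`levelSum_add_eq_of_exact`), so `|Σ_c w_c φ(c) + φ(0)| ≤ B·η + η₀` whenever `|φ - p| ≤ η` on `C` and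
  `≤ η₀` at `0` (`abs_levelSum_add_le_of_exact_of_poly`); with the Newton polynomial,
  `Σ_c w_c φ(c) + φ(0) = Σ_c w_c R_D(c)φ` (`levelSum_add_eq_sum_newtonRem`) and
  **`|Σ_c w_c φ(c) + φ(0)| ≤ B · C(T, D+1) · max_{j+D+1 ≤ T} |Δ^{D+1}φ(j)| ≤ B · T^{D+1}/(D+1)! · max|Δ^{D+1}φ|`**
  (`abs_levelSum_add_le_of_exact_of_fwdDiff`, `…_pow`).
* §3 the same three bounds for `IsExactDesign n t T D B C w` (`IsExactDesign.abs_levelSum_add_le_of_poly`,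
  `…_of_fwdDiff`, `…_of_fwdDiff_pow`), and §4 the derivative form: if `φ = g|_ℕ` for a `g` with `D + 1`
  derivatives on `[0, T]` and `|g^{(D+1)}| ≤ K` there, then `|Δ^{D+1}φ(j)| ≤ K` (iterated mean value
  inequality, the tree's `Literature.Analysis.norm_fwdDiff_iter_le_of_hasDerivAt`
  [cite: BenfattoGiulianiMastropietro2006, (2.36aa)]) and so `|Σ_c w_c g(c) + g(0)| ≤ B · C(T, D+1) · K`
  (`IsExactDesign.abs_levelSum_add_le_of_hasDerivAt`; Mathlib `ContDiff`/`iteratedDeriv` form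
  `IsExactDesign.abs_levelSum_add_le_of_contDiff`, `…_pow`).
* §5 ODD LEVELS (the `t`-cut level classes live on `c = 2j+1`): the step-2 Newton polynomial
  `newtonPolyOdd D φ = N_D ψ((X−1)/2)`, `ψ(j) = φ(2j+1)`, and
  `|Σ_c w_c φ(c) + N^{odd}_D φ(0)| ≤ B · C((T−1)/2, D+1) · max_j |Δ^{D+1}ψ(j)|`
  (`abs_levelSum_add_le_of_exact_of_fwdDiff_odd`, `IsExactDesign.abs_levelSum_add_le_of_fwdDiff_odd`):
  the virtual value is the extrapolated one, and only STEP-2 differences of the profile are needed.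
* §6 the EXACT Newton form (no truncation; Newton's formula = Mathlib `shift_eq_sum_fwdDiff_iter`):
  with the design's Newton moments `m_k = Σ_c w_c C((c−1)/2, k)` (`newtonMomentOdd`; `= −C(−1/2,k)`
  for `k ≤ D` by exactness, `newtonMomentOdd_eq_of_le`; `|m_k| ≤ B·C(N,k)`, `abs_newtonMomentOdd_le`),
  `Σ_c w_c φ(c) + N^{odd}_D φ(0) = Σ_{k=D+1}^{N} m_k · Δ^kψ(0)` (`levelSum_add_eq_sum_Ico_newtonMomentOdd`)
  — design and profile separated: only the profile's Newton coefficients at the base level enter.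

Reading for the cell (`T = Tq n ≍ 4√n`, `D = dq n ≍ n^{1/4}`, `B = 20`): a level profile whose
`(D+1)`-st differences on `[0, T]` are `≤ K` is priced by every exact design to within
`20 · C(T, D+1) · K ≤ 20 · (T^{D+1}/(D+1)!) · K`; "analytic on scale `L`" (`|Δ^{D+1}φ| ≲ (D+1)!·M/L^{D+1}`)
gives `≲ 20 M (T/L)^{D+1}`. Profiles that are polynomial of degree `≤ D` in the level (juntas of
size `≤ D`) have `Δ^{D+1}φ = 0` and are priced exactly. Nothing here is specific to matchings: §§1–2
are stated for arbitrary weights `w` on a finite set of natural nodes.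

Not restated: Newton's formula without remainder is Mathlib's `shift_eq_sum_fwdDiff_iter`; a
`ℤ`-indexed remainder bound for a custom difference operator is
`Literature.Barriers.CriticalPhenomena.LongRangePhi4.Bump.abs_taylorRem_le` (Brydges–Slade); the
Cauchy remainder of Lagrange interpolation at real nodes is
`Literature/Analysis/Approximation/InterpolationRemainder.lean`, and Lebesgue functions of
extrapolation are in `Literature/Analysis/Approximation/ExtrapolationLebesgueFunction.lean`.

## References

* [Agarwal2000DifferenceEquations] R. P. Agarwal, *Difference Equations and Inequalities: Theory,
  Methods, and Applications*, 2nd ed., Marcel Dekker, 2000, §1.8, Theorem 1.8.5 and Remark 1.8.1.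
* [Rivlin1974] T. J. Rivlin, *The Chebyshev Polynomials*, Wiley, 1974, Sect. 1.3 (1.32)–(1.34) and
  p. 121 (errors in extrapolation).
* [BenfattoGiulianiMastropietro2006] G. Benfatto, A. Giuliani, V. Mastropietro, Ann. Henri Poincaré 7
  (2006), (2.36aa) (iterated mean value inequality, as vendored in
  `Literature/Analysis/Calculus/IteratedDifferenceBound.lean`).
* [Rothvoss2017] T. Rothvoß, *The matching polytope has exponential extension complexity*, J. ACM 64
  (2017), §2 (the level weights `w_c`). [CoppersmithRivlin1992] D. Coppersmith, T. J. Rivlin, SIAM J.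
  Math. Anal. 23 (1992) (the regime `D² ≤ T/4` of `IsExactDesign`).
-/

noncomputable section

open Finset Polynomial

namespace Literature.Combinatorics.Optimization

namespace DesignRemainder

/-! ### §1 Newton's forward-difference formula with remainder -/

/-- Hockey stick over `range`: `Σ_{j < m} C(j, s) = C(m, s+1)` (cast to `ℝ`).
[cite: Agarwal2000DifferenceEquations, Thm. 1.8.5 (proof, summation step)] -/
theorem sum_range_choose_cast (m s : ℕ) :
    ∑ j ∈ range m, ((j.choose s : ℕ) : ℝ) = ((m.choose (s + 1) : ℕ) : ℝ) := by
  induction m with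
  | zero => simp
  | succ m ih => rw [sum_range_succ, ih, Nat.choose_succ_succ', Nat.cast_add, add_comm]

/-- Reflected hockey stick: `Σ_{j < m} C(m-1-j, s) = C(m, s+1)` — the total mass of the Newton
remainder kernel, `Σ_{ℓ} (k-ℓ-1)^{(n-1)}/(n-1)! = (k-a)^{(n)}/n!`.
[cite: Agarwal2000DifferenceEquations, Remark 1.8.1 (1.8.8)] -/
theorem sum_range_choose_sub_cast (m s : ℕ) :
    ∑ j ∈ range m, (((m - 1 - j).choose s : ℕ) : ℝ) = ((m.choose (s + 1) : ℕ) : ℝ) := by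
  rw [sum_range_reflect (fun j => ((j.choose s : ℕ) : ℝ)) m, sum_range_choose_cast]

/-- The **Newton (discrete Taylor) remainder** of order `D` at the base point `0`, evaluated at `m`:
`R_D(m)φ = φ(m) - Σ_{k ≤ D} C(m,k) (Δ^k φ)(0)` (the first sum in (1.8.6) is Newton's forward-difference
interpolating polynomial, `(k-a)^{(i)}/i! = C(k-a, i)`).
[cite: Agarwal2000DifferenceEquations, Thm. 1.8.5 (1.8.6), Remark 1.8.1] -/
def newtonRem (D m : ℕ) (φ : ℕ → ℝ) : ℝ :=
  φ m - ∑ k ∈ range (D + 1), ((m.choose k : ℕ) : ℝ) * ((fwdDiff (1 : ℕ))^[k] φ) 0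

/-- Order `0`: `R_0(m)φ = φ(m) - φ(0)`. [cite: Agarwal2000DifferenceEquations, Thm. 1.8.5 (case n = 1)] -/
theorem newtonRem_zero_left (m : ℕ) (φ : ℕ → ℝ) : newtonRem 0 m φ = φ m - φ 0 := by
  simp [newtonRem]

/-- At the base point the remainder vanishes: `R_D(0)φ = 0`.
[cite: Agarwal2000DifferenceEquations, Thm. 1.8.5 (1.8.6) at k = a] -/
theorem newtonRem_zero_right (D : ℕ) (φ : ℕ → ℝ) : newtonRem D 0 φ = 0 := by
  rw [newtonRem, sum_range_succ',
    sum_eq_zero fun k _ => by rw [Nat.choose_zero_succ, Nat.cast_zero, zero_mul]]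
  simp

/-- Pascal recursion of the remainder in the evaluation point:
`R_{D+1}(m+1)φ = R_{D+1}(m)φ + R_D(m)(Δφ)`.
[cite: Agarwal2000DifferenceEquations, Thm. 1.8.5 (proof, induction step)] -/
theorem newtonRem_succ_succ (D m : ℕ) (φ : ℕ → ℝ) :
    newtonRem (D + 1) (m + 1) φ = newtonRem (D + 1) m φ + newtonRem D m (fwdDiff 1 φ) := by
  have h1 : ∑ k ∈ range (D + 1 + 1), (((m + 1).choose k : ℕ) : ℝ) * ((fwdDiff (1 : ℕ))^[k] φ) 0 =
      ((fwdDiff (1 : ℕ))^[0] φ) 0 + ∑ k ∈ range (D + 1),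
        (((m.choose k : ℕ) : ℝ) + ((m.choose (k + 1) : ℕ) : ℝ)) * ((fwdDiff (1 : ℕ))^[k + 1] φ) 0 := by
    rw [sum_range_succ']
    simp only [Nat.choose_zero_right, Nat.cast_one, one_mul, Nat.choose_succ_succ', Nat.cast_add]
    ring
  have h2 : ∑ k ∈ range (D + 1 + 1), ((m.choose k : ℕ) : ℝ) * ((fwdDiff (1 : ℕ))^[k] φ) 0 =
      ((fwdDiff (1 : ℕ))^[0] φ) 0 + ∑ k ∈ range (D + 1), ((m.choose (k + 1) : ℕ) : ℝ) * ((fwdDiff (1 : ℕ))^[k + 1] φ) 0 := by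
    rw [sum_range_succ']
    simp only [Nat.choose_zero_right, Nat.cast_one, one_mul]
    ring
  have h3 : ∀ k, ((fwdDiff (1 : ℕ))^[k] (fwdDiff 1 φ)) 0 = ((fwdDiff (1 : ℕ))^[k + 1] φ) 0 := fun k => by
    rw [Function.iterate_succ_apply]
  have h4 : (fwdDiff 1 φ) m = φ (m + 1) - φ m := rfl
  simp only [newtonRem, h1, h2, h3, h4, Function.iterate_zero_apply, add_mul, sum_add_distrib]
  ring

/-- **Discrete Taylor formula with remainder** (Agarwal (1.8.6), `a = 0`, `n = D + 1`), kernel form: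
`R_D(m)φ = Σ_{j < m} C(m-1-j, D) (Δ^{D+1} φ)(j)` (the terms with `j > m-1-D` vanish).
[cite: Agarwal2000DifferenceEquations, Thm. 1.8.5 (1.8.6)] -/
theorem newtonRem_eq_sum (D : ℕ) : ∀ (m : ℕ) (φ : ℕ → ℝ),
    newtonRem D m φ = ∑ j ∈ range m, (((m - 1 - j).choose D : ℕ) : ℝ) * ((fwdDiff (1 : ℕ))^[D + 1] φ) j := by
  induction D with
  | zero =>
    intro m φ
    rw [newtonRem_zero_left]
    simp only [Nat.choose_zero_right, Nat.cast_one, one_mul]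
    exact (sum_range_sub φ m).symm
  | succ D ih =>
    intro m
    induction m with
    | zero => intro φ; simp [newtonRem_zero_right]
    | succ m ihm =>
      intro φ
      rw [newtonRem_succ_succ, ihm φ, ih m (fwdDiff 1 φ), sum_range_succ]
      simp only [Nat.add_sub_cancel, Nat.sub_self, Nat.choose_zero_succ, Nat.cast_zero, zero_mul,
        add_zero]
      rw [← sum_add_distrib]
      refine sum_congr rfl fun j hj => ?_
      have hjm : j < m := mem_range.1 hj
      have hmj : m - j = (m - 1 - j) + 1 := by omega
      rw [hmj, Nat.choose_succ_succ', Nat.cast_add]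
      simp only [Function.iterate_succ_apply]
      ring

/-- **Newton remainder bound** (Agarwal, Remark 1.8.1, (1.8.8)):
`|R_D(m)φ| ≤ C(m, D+1) · max_{j + D + 1 ≤ m} |Δ^{D+1} φ(j)|` — "for the remainder Lagrange's analog is
not expected … one has an error estimate only in terms of `Δⁿu`".
[cite: Agarwal2000DifferenceEquations, Remark 1.8.1 (1.8.8)] -/
theorem abs_newtonRem_le (D m : ℕ) (φ : ℕ → ℝ) {K : ℝ}
    (hK : ∀ j : ℕ, j + D + 1 ≤ m → |((fwdDiff (1 : ℕ))^[D + 1] φ) j| ≤ K) :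
    |newtonRem D m φ| ≤ ((m.choose (D + 1) : ℕ) : ℝ) * K := by
  rw [newtonRem_eq_sum, ← sum_range_choose_sub_cast, sum_mul]
  refine (abs_sum_le_sum_abs _ _).trans (sum_le_sum fun j hj => ?_)
  have hjm : j < m := mem_range.1 hj
  rw [abs_mul, Nat.abs_cast]
  by_cases h : j + D + 1 ≤ m
  · exact mul_le_mul_of_nonneg_left (hK j h) (Nat.cast_nonneg _)
  · rw [Nat.choose_eq_zero_of_lt (by omega), Nat.cast_zero, zero_mul, zero_mul]

/-- Sign form: if `Δ^{D+1}φ ≥ 0` on `{j : j + D + 1 ≤ m}` then `R_D(m)φ ≥ 0` (the kernel of (1.8.6) is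
nonnegative). [cite: Agarwal2000DifferenceEquations, Thm. 1.8.5 (1.8.6)] -/
theorem newtonRem_nonneg (D m : ℕ) (φ : ℕ → ℝ)
    (h : ∀ j : ℕ, j + D + 1 ≤ m → 0 ≤ ((fwdDiff (1 : ℕ))^[D + 1] φ) j) : 0 ≤ newtonRem D m φ := by
  rw [newtonRem_eq_sum]
  refine sum_nonneg fun j hj => ?_
  have hjm : j < m := mem_range.1 hj
  by_cases hj' : j + D + 1 ≤ m
  · exact mul_nonneg (Nat.cast_nonneg _) (h j hj')
  · rw [Nat.choose_eq_zero_of_lt (by omega), Nat.cast_zero, zero_mul]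

/-- Sign form: if `Δ^{D+1}φ ≤ 0` on `{j : j + D + 1 ≤ m}` then `R_D(m)φ ≤ 0`.
[cite: Agarwal2000DifferenceEquations, Thm. 1.8.5 (1.8.6)] -/
theorem newtonRem_nonpos (D m : ℕ) (φ : ℕ → ℝ)
    (h : ∀ j : ℕ, j + D + 1 ≤ m → ((fwdDiff (1 : ℕ))^[D + 1] φ) j ≤ 0) : newtonRem D m φ ≤ 0 := by
  rw [newtonRem_eq_sum]
  refine sum_nonpos fun j hj => ?_
  have hjm : j < m := mem_range.1 hj
  by_cases hj' : j + D + 1 ≤ m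
  · exact mul_nonpos_of_nonneg_of_nonpos (Nat.cast_nonneg _) (h j hj')
  · rw [Nat.choose_eq_zero_of_lt (by omega), Nat.cast_zero, zero_mul]

/-! ### The Newton polynomial as a real polynomial of degree `≤ D` -/

/-- The binomial-coefficient polynomial `C(X, k) = X(X-1)⋯(X-k+1)/k!` over `ℝ` (the factorial
polynomial `(k-a)^{(i)}/i!` of (1.8.6) with `a = 0`).
[cite: Agarwal2000DifferenceEquations, Thm. 1.8.5 (1.8.6), Remark 1.8.1] -/
def chooseX (k : ℕ) : ℝ[X] := C ((k.factorial : ℝ)⁻¹) * descPochhammer ℝ k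

/-- `C(X, k)` at a natural number `j` is `C(j, k)`.
[cite: Agarwal2000DifferenceEquations, Thm. 1.8.5 (1.8.6)] -/
theorem chooseX_eval_natCast (k j : ℕ) : (chooseX k).eval (j : ℝ) = ((j.choose k : ℕ) : ℝ) := by
  unfold chooseX
  rw [eval_mul, eval_C, descPochhammer_eval_eq_descFactorial ℝ j k,
    Nat.descFactorial_eq_factorial_mul_choose]
  have h : (k.factorial : ℝ) ≠ 0 := by positivity
  push_cast
  field_simp

/-- `deg C(X, k) ≤ k`. [cite: Agarwal2000DifferenceEquations, Thm. 1.8.5 (1.8.6)] -/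
theorem natDegree_chooseX_le (k : ℕ) : (chooseX k).natDegree ≤ k := by
  unfold chooseX
  refine (natDegree_C_mul_le _ _).trans ?_
  rw [descPochhammer_natDegree]

/-- **Newton's forward-difference interpolating polynomial** of degree `≤ D` at the base point `0`:
`N_D φ = Σ_{k ≤ D} (Δ^k φ)(0) · C(X, k)` (the first term of (1.8.6)).
[cite: Agarwal2000DifferenceEquations, Thm. 1.8.5 (1.8.6), Remark 1.8.1] -/
def newtonPoly (D : ℕ) (φ : ℕ → ℝ) : ℝ[X] :=
  ∑ k ∈ range (D + 1), C (((fwdDiff (1 : ℕ))^[k] φ) 0) * chooseX k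

/-- `N_D φ (m) = Σ_{k ≤ D} C(m,k) (Δ^k φ)(0)` at natural `m`.
[cite: Agarwal2000DifferenceEquations, Thm. 1.8.5 (1.8.6)] -/
theorem newtonPoly_eval_natCast (D : ℕ) (φ : ℕ → ℝ) (m : ℕ) :
    (newtonPoly D φ).eval (m : ℝ) = ∑ k ∈ range (D + 1), ((m.choose k : ℕ) : ℝ) * ((fwdDiff (1 : ℕ))^[k] φ) 0 := by
  rw [newtonPoly, eval_finsetSum]
  exact sum_congr rfl fun k _ => by rw [eval_mul, eval_C, chooseX_eval_natCast, mul_comm]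

/-- `φ(m) - N_D φ(m) = R_D(m)φ`. [cite: Agarwal2000DifferenceEquations, Thm. 1.8.5 (1.8.6)] -/
theorem sub_newtonPoly_eval (D m : ℕ) (φ : ℕ → ℝ) :
    φ m - (newtonPoly D φ).eval (m : ℝ) = newtonRem D m φ := by
  rw [newtonPoly_eval_natCast]
  rfl

/-- The Newton polynomial interpolates at the base point: `N_D φ (0) = φ(0)`.
[cite: Agarwal2000DifferenceEquations, Thm. 1.8.5 (1.8.6) at k = a] -/
theorem newtonPoly_eval_zero (D : ℕ) (φ : ℕ → ℝ) : (newtonPoly D φ).eval 0 = φ 0 := by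
  have h := sub_newtonPoly_eval D 0 φ
  rw [newtonRem_zero_right, Nat.cast_zero, sub_eq_zero] at h
  exact h.symm

/-- `deg N_D φ ≤ D`. [cite: Agarwal2000DifferenceEquations, Remark 1.8.1] -/
theorem natDegree_newtonPoly_le (D : ℕ) (φ : ℕ → ℝ) : (newtonPoly D φ).natDegree ≤ D := by
  unfold newtonPoly
  refine natDegree_sum_le_of_forall_le _ _ fun k hk => ?_
  exact (natDegree_C_mul_le _ _).trans
    ((natDegree_chooseX_le k).trans (Nat.lt_succ_iff.1 (mem_range.1 hk)))

/-! ### Differences of a sampled smooth function -/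

/-- **Iterated differences of a sampled function are bounded by its derivative**: if
`g 0, …, g N : ℝ → ℝ` is a chain of derivatives on `[j, j + N]` (`HasDerivAt (g k) (g (k+1) x) x`) and
`|g N| ≤ K` there, then the `N`-th unit-step difference of the sample `m ↦ g 0 m` at `j` is `≤ K` in
absolute value (iterated mean value inequality; the tree's
`Literature.Analysis.norm_fwdDiff_iter_le_of_hasDerivAt` with `δ = 1`, transported to the `ℕ`-sample
by `Literature.Analysis.fwdDiff_iter_eq_smul_of_sample`).
[cite: BenfattoGiulianiMastropietro2006, (2.36aa)] -/
theorem abs_fwdDiff_iter_natCast_le_of_hasDerivAt (N j : ℕ) (g : ℕ → ℝ → ℝ) {K : ℝ}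
    (hder : ∀ k < N, ∀ x ∈ Set.Icc (j : ℝ) (j + N), HasDerivAt (g k) (g (k + 1) x) x)
    (hbd : ∀ x ∈ Set.Icc (j : ℝ) (j + N), |g N x| ≤ K) :
    |((fwdDiff (1 : ℕ))^[N] (fun m : ℕ => g 0 m)) j| ≤ K := by
  have hs : ((fwdDiff (1 : ℕ))^[N] (fun m : ℕ => g 0 m)) j = (1 : ℝ) • ((fwdDiff (1 : ℝ))^[N] (g 0)) (j : ℝ) :=
    Literature.Analysis.fwdDiff_iter_eq_smul_of_sample (G := fun m : ℕ => g 0 m) (f := g 0)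
      (y := (j : ℝ)) (y' := j) (h := (1 : ℝ)) (h' := (1 : ℕ)) (K := (1 : ℝ)) (n := N)
      fun k _ => by simp
  rw [hs, one_smul]
  have h := Literature.Analysis.norm_fwdDiff_iter_le_of_hasDerivAt zero_le_one N g (j : ℝ) K
    (fun k hk x hx => hder k hk x (by simpa using hx))
    (fun x hx => by rw [Real.norm_eq_abs]; exact hbd x (by simpa using hx))
  simpa [Real.norm_eq_abs] using h

end DesignRemainder

open DesignRemainder

/-! ### §2 The Lebesgue inequality for a rule exact at `0` in degree `≤ D` -/

section ExactRule

variable {C : Finset ℕ} {w : ℕ → ℝ} {D : ℕ}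

/-- **Lebesgue's identity**: if `Σ_{c ∈ C} w_c p(c) = -p(0)` for all `p` of degree `≤ D`, then for
every `φ` and every such `p`, `Σ_c w_c φ(c) + φ(0) = Σ_c w_c (φ - p)(c) + (φ - p)(0)` — the design
error only sees the distance of `φ` to `𝒫_D`. [cite: Rivlin1974, Sect. 1.3 (1.32)–(1.34)] -/
theorem levelSum_add_eq_of_exact
    (hex : ∀ p : ℝ[X], p.natDegree ≤ D → ∑ c ∈ C, w c * p.eval (c : ℝ) = -p.eval 0)
    (φ : ℕ → ℝ) {p : ℝ[X]} (hp : p.natDegree ≤ D) :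
    ∑ c ∈ C, w c * φ c + φ 0 = ∑ c ∈ C, w c * (φ c - p.eval (c : ℝ)) + (φ 0 - p.eval 0) := by
  have h := hex p hp
  simp only [mul_sub, sum_sub_distrib, h]
  ring

/-- A rule exact at `0` (already for constants) has at least one node.
[cite: Rivlin1974, Sect. 1.3 (1.32)–(1.34)] -/
theorem nonempty_of_exact
    (hex : ∀ p : ℝ[X], p.natDegree ≤ D → ∑ c ∈ C, w c * p.eval (c : ℝ) = -p.eval 0) :
    C.Nonempty := by
  by_contra h
  have h1 := hex (Polynomial.C (1 : ℝ)) (by simp)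
  rw [not_nonempty_iff_eq_empty.1 h] at h1
  simp at h1

/-- **Lebesgue inequality for an exact rule**: if `Σ_c |w_c| ≤ B`, `|φ - p| ≤ η` on the nodes and
`|φ(0) - p(0)| ≤ η₀` for some polynomial `p` of degree `≤ D`, then `|Σ_c w_c φ(c) + φ(0)| ≤ B η + η₀`
("`|f - L_k f| ≤ E_k (1 + Λ)`"; "the error in the extrapolation due to the `ε_i` does not exceed
`ε Σ_i |l_i(t)|`"). [cite: Rivlin1974, Sect. 1.3 (1.32)–(1.34); p. 121] -/
theorem abs_levelSum_add_le_of_exact_of_poly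
    (hex : ∀ p : ℝ[X], p.natDegree ≤ D → ∑ c ∈ C, w c * p.eval (c : ℝ) = -p.eval 0)
    {B : ℝ} (hB : ∑ c ∈ C, |w c| ≤ B) (φ : ℕ → ℝ) {p : ℝ[X]} (hp : p.natDegree ≤ D)
    {η η₀ : ℝ} (hη : ∀ c ∈ C, |φ c - p.eval (c : ℝ)| ≤ η) (hη₀ : |φ 0 - p.eval 0| ≤ η₀) :
    |∑ c ∈ C, w c * φ c + φ 0| ≤ B * η + η₀ := by
  obtain ⟨c₀, hc₀⟩ := nonempty_of_exact hex
  have hη0 : 0 ≤ η := (abs_nonneg _).trans (hη c₀ hc₀)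
  rw [levelSum_add_eq_of_exact hex φ hp]
  refine (abs_add_le _ _).trans (add_le_add ?_ hη₀)
  calc |∑ c ∈ C, w c * (φ c - p.eval (c : ℝ))|
      ≤ ∑ c ∈ C, |w c * (φ c - p.eval (c : ℝ))| := abs_sum_le_sum_abs _ _
    _ ≤ ∑ c ∈ C, |w c| * η := sum_le_sum fun c hc => by
        rw [abs_mul]
        exact mul_le_mul_of_nonneg_left (hη c hc) (abs_nonneg _)
    _ = (∑ c ∈ C, |w c|) * η := by rw [sum_mul]
    _ ≤ B * η := mul_le_mul_of_nonneg_right hB hη0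

/-- The design error is the rule applied to the Newton remainder:
`Σ_c w_c φ(c) + φ(0) = Σ_c w_c R_D(c)φ` (Lebesgue's identity with `p = N_D φ`, which has degree `≤ D`
and `N_D φ(0) = φ(0)`).
[cite: Agarwal2000DifferenceEquations, Remark 1.8.1 (1.8.8)] [cite: Rivlin1974, Sect. 1.3 (1.32)–(1.34)] -/
theorem levelSum_add_eq_sum_newtonRem
    (hex : ∀ p : ℝ[X], p.natDegree ≤ D → ∑ c ∈ C, w c * p.eval (c : ℝ) = -p.eval 0)
    (φ : ℕ → ℝ) :
    ∑ c ∈ C, w c * φ c + φ 0 = ∑ c ∈ C, w c * newtonRem D c φ := by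
  rw [levelSum_add_eq_of_exact hex φ (natDegree_newtonPoly_le D φ), newtonPoly_eval_zero, sub_self,
    add_zero]
  exact sum_congr rfl fun c _ => by rw [sub_newtonPoly_eval]

/-- **Design error by `(D+1)`-st differences**: for a rule exact at `0` in degree `≤ D` with nodes
`≤ T` and `Σ_c |w_c| ≤ B`, and a profile with `|Δ^{D+1}φ(j)| ≤ K` for `j + D + 1 ≤ T`,
`|Σ_c w_c φ(c) + φ(0)| ≤ B · C(T, D+1) · K`.
[cite: Agarwal2000DifferenceEquations, Remark 1.8.1 (1.8.8)] [cite: Rivlin1974, Sect. 1.3 (1.32)–(1.34)] -/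
theorem abs_levelSum_add_le_of_exact_of_fwdDiff
    (hex : ∀ p : ℝ[X], p.natDegree ≤ D → ∑ c ∈ C, w c * p.eval (c : ℝ) = -p.eval 0)
    {B : ℝ} (hB : ∑ c ∈ C, |w c| ≤ B) {T : ℕ} (hT : ∀ c ∈ C, c ≤ T)
    (φ : ℕ → ℝ) {K : ℝ} (hK0 : 0 ≤ K) (hK : ∀ j : ℕ, j + D + 1 ≤ T → |((fwdDiff (1 : ℕ))^[D + 1] φ) j| ≤ K) :
    |∑ c ∈ C, w c * φ c + φ 0| ≤ B * ((T.choose (D + 1) : ℕ) : ℝ) * K := by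
  rw [levelSum_add_eq_sum_newtonRem hex φ]
  calc |∑ c ∈ C, w c * newtonRem D c φ|
      ≤ ∑ c ∈ C, |w c * newtonRem D c φ| := abs_sum_le_sum_abs _ _
    _ ≤ ∑ c ∈ C, |w c| * (((T.choose (D + 1) : ℕ) : ℝ) * K) := sum_le_sum fun c hc => by
        rw [abs_mul]
        refine mul_le_mul_of_nonneg_left ?_ (abs_nonneg _)
        calc |newtonRem D c φ| ≤ ((c.choose (D + 1) : ℕ) : ℝ) * K :=
              abs_newtonRem_le D c φ fun j hj => hK j (hj.trans (hT c hc))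
          _ ≤ ((T.choose (D + 1) : ℕ) : ℝ) * K :=
              mul_le_mul_of_nonneg_right (Nat.cast_le.2 (Nat.choose_le_choose _ (hT c hc))) hK0
    _ = (∑ c ∈ C, |w c|) * (((T.choose (D + 1) : ℕ) : ℝ) * K) := by rw [sum_mul]
    _ ≤ B * (((T.choose (D + 1) : ℕ) : ℝ) * K) := mul_le_mul_of_nonneg_right hB (by positivity)
    _ = B * ((T.choose (D + 1) : ℕ) : ℝ) * K := by ring

/-- The same with `C(T, D+1) ≤ T^{D+1}/(D+1)!`: `|Σ_c w_c φ(c) + φ(0)| ≤ B · T^{D+1}/(D+1)! · K`.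
[cite: Agarwal2000DifferenceEquations, Remark 1.8.1 (1.8.8)] [cite: Rivlin1974, Sect. 1.3 (1.32)–(1.34)] -/
theorem abs_levelSum_add_le_of_exact_of_fwdDiff_pow
    (hex : ∀ p : ℝ[X], p.natDegree ≤ D → ∑ c ∈ C, w c * p.eval (c : ℝ) = -p.eval 0)
    {B : ℝ} (hB : ∑ c ∈ C, |w c| ≤ B) {T : ℕ} (hT : ∀ c ∈ C, c ≤ T)
    (φ : ℕ → ℝ) {K : ℝ} (hK0 : 0 ≤ K) (hK : ∀ j : ℕ, j + D + 1 ≤ T → |((fwdDiff (1 : ℕ))^[D + 1] φ) j| ≤ K) :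
    |∑ c ∈ C, w c * φ c + φ 0| ≤ B * ((T : ℝ) ^ (D + 1) / ((D + 1).factorial : ℝ)) * K := by
  have hB0 : 0 ≤ B := (sum_nonneg fun c _ => abs_nonneg (w c)).trans hB
  refine (abs_levelSum_add_le_of_exact_of_fwdDiff hex hB hT φ hK0 hK).trans ?_
  have hc : ((T.choose (D + 1) : ℕ) : ℝ) ≤ (T : ℝ) ^ (D + 1) / ((D + 1).factorial : ℝ) := by
    have := Nat.choose_le_pow_div (D + 1) T (α := ℝ)
    simpa using this
  exact mul_le_mul_of_nonneg_right (mul_le_mul_of_nonneg_left hc hB0) hK0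

end ExactRule

/-! ### §3 The bounds for an exact extrapolation design `IsExactDesign n t T D B C w` -/

namespace IsExactDesign

variable {n t T D : ℕ} {B : ℝ} {C : Finset ℕ} {w : ℕ → ℝ}

/-- The levels of an exact design are `≤ T`. [cite: Rothvoss2017, §2 (PDF p. 6)] -/
theorem level_le (h : IsExactDesign n t T D B C w) : ∀ c ∈ C, c ≤ T :=
  fun c hc => (h.2.2.2.1 c hc).2.2.1

/-- Exactness at the virtual level `0` for degree `≤ D`. [cite: CoppersmithRivlin1992, Thm. (p. 970)] -/
theorem exact (h : IsExactDesign n t T D B C w) :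
    ∀ p : ℝ[X], p.natDegree ≤ D → ∑ c ∈ C, w c * p.eval (c : ℝ) = -p.eval 0 :=
  h.2.2.2.2.2.1

/-- The total variation bound `Σ_c |w_c| ≤ B`. [cite: CoppersmithRivlin1992, Thm. (p. 970)] -/
theorem variation_le (h : IsExactDesign n t T D B C w) : ∑ c ∈ C, |w c| ≤ B :=
  h.2.2.2.2.2.2

/-- **Lebesgue inequality for an exact design**: `|Σ_c w_c φ(c) + φ(0)| ≤ B η + η₀` whenever some
polynomial of degree `≤ D` is `η`-close to `φ` on the levels and `η₀`-close at `0`.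
[cite: Rivlin1974, Sect. 1.3 (1.32)–(1.34); p. 121] -/
theorem abs_levelSum_add_le_of_poly (h : IsExactDesign n t T D B C w) (φ : ℕ → ℝ) {p : ℝ[X]}
    (hp : p.natDegree ≤ D) {η η₀ : ℝ} (hη : ∀ c ∈ C, |φ c - p.eval (c : ℝ)| ≤ η)
    (hη₀ : |φ 0 - p.eval 0| ≤ η₀) :
    |∑ c ∈ C, w c * φ c + φ 0| ≤ B * η + η₀ :=
  abs_levelSum_add_le_of_exact_of_poly h.exact h.variation_le φ hp hη hη₀

/-- **Design error by `(D+1)`-st level differences**: for an exact design of degree `D` on levels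
`≤ T` with variation `≤ B`, `|Σ_c w_c φ(c) + φ(0)| ≤ B · C(T, D+1) · max_{j+D+1 ≤ T} |Δ^{D+1}φ(j)|`.
[cite: Agarwal2000DifferenceEquations, Remark 1.8.1 (1.8.8)] [cite: Rivlin1974, Sect. 1.3 (1.32)–(1.34)] -/
theorem abs_levelSum_add_le_of_fwdDiff (h : IsExactDesign n t T D B C w) (φ : ℕ → ℝ) {K : ℝ}
    (hK0 : 0 ≤ K) (hK : ∀ j : ℕ, j + D + 1 ≤ T → |((fwdDiff (1 : ℕ))^[D + 1] φ) j| ≤ K) :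
    |∑ c ∈ C, w c * φ c + φ 0| ≤ B * ((T.choose (D + 1) : ℕ) : ℝ) * K :=
  abs_levelSum_add_le_of_exact_of_fwdDiff h.exact h.variation_le h.level_le φ hK0 hK

/-- Power form: `|Σ_c w_c φ(c) + φ(0)| ≤ B · T^{D+1}/(D+1)! · max |Δ^{D+1}φ|`.
[cite: Agarwal2000DifferenceEquations, Remark 1.8.1 (1.8.8)] [cite: Rivlin1974, Sect. 1.3 (1.32)–(1.34)] -/
theorem abs_levelSum_add_le_of_fwdDiff_pow (h : IsExactDesign n t T D B C w) (φ : ℕ → ℝ) {K : ℝ}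
    (hK0 : 0 ≤ K) (hK : ∀ j : ℕ, j + D + 1 ≤ T → |((fwdDiff (1 : ℕ))^[D + 1] φ) j| ≤ K) :
    |∑ c ∈ C, w c * φ c + φ 0| ≤ B * ((T : ℝ) ^ (D + 1) / ((D + 1).factorial : ℝ)) * K :=
  abs_levelSum_add_le_of_exact_of_fwdDiff_pow h.exact h.variation_le h.level_le φ hK0 hK

/-! ### §4 Derivative form -/

/-- **Design error for a sampled smooth profile**: if `φ = g|_ℕ` where `g = g 0` has a chain of
`D + 1` derivatives `g 1, …, g (D+1)` on `[0, T]` with `|g (D+1)| ≤ K` there, then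
`|Σ_c w_c g(c) + g(0)| ≤ B · C(T, D+1) · K` (iterated mean value inequality + Newton remainder +
Lebesgue identity). [cite: Agarwal2000DifferenceEquations, Remark 1.8.1 (1.8.8)]
[cite: BenfattoGiulianiMastropietro2006, (2.36aa)] -/
theorem abs_levelSum_add_le_of_hasDerivAt (h : IsExactDesign n t T D B C w) (g : ℕ → ℝ → ℝ)
    {K : ℝ} (hK0 : 0 ≤ K)
    (hder : ∀ k < D + 1, ∀ x ∈ Set.Icc (0 : ℝ) T, HasDerivAt (g k) (g (k + 1) x) x)
    (hbd : ∀ x ∈ Set.Icc (0 : ℝ) T, |g (D + 1) x| ≤ K) :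
    |∑ c ∈ C, w c * g 0 c + g 0 0| ≤ B * ((T.choose (D + 1) : ℕ) : ℝ) * K := by
  have hsub : ∀ j : ℕ, j + D + 1 ≤ T → ∀ x ∈ Set.Icc (j : ℝ) (j + (D + 1 : ℕ)),
      x ∈ Set.Icc (0 : ℝ) T := fun j hj x hx =>
    ⟨(Nat.cast_nonneg j).trans hx.1, hx.2.trans (by exact_mod_cast (by omega : j + (D + 1) ≤ T))⟩
  have := h.abs_levelSum_add_le_of_fwdDiff (fun m : ℕ => g 0 m) hK0 fun j hj =>
    abs_fwdDiff_iter_natCast_le_of_hasDerivAt (D + 1) j g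
      (fun k hk x hx => hder k hk x (hsub j hj x hx)) (fun x hx => hbd x (hsub j hj x hx))
  simpa using this

/-- **Design error for a sampled `C^{D+2}` profile** (Mathlib `ContDiff` / `iteratedDeriv` form of the
previous lemma): if `f : ℝ → ℝ` is `C^{D+2}` and `|f^{(D+1)}| ≤ K` on `[0, T]`, then
`|Σ_c w_c f(c) + f(0)| ≤ B · C(T, D+1) · K` (take `g k = iteratedDeriv k f`; `f^{(k)}` has derivative
`f^{(k+1)}` by `iteratedDeriv_succ`). [cite: Agarwal2000DifferenceEquations, Remark 1.8.1 (1.8.8)]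
[cite: BenfattoGiulianiMastropietro2006, (2.36aa)] -/
theorem abs_levelSum_add_le_of_contDiff (h : IsExactDesign n t T D B C w) (f : ℝ → ℝ)
    (hf : ContDiff ℝ (D + 2) f) {K : ℝ} (hK0 : 0 ≤ K)
    (hbd : ∀ x ∈ Set.Icc (0 : ℝ) T, |iteratedDeriv (D + 1) f x| ≤ K) :
    |∑ c ∈ C, w c * f c + f 0| ≤ B * ((T.choose (D + 1) : ℕ) : ℝ) * K := by
  have hder : ∀ k < D + 1, ∀ x ∈ Set.Icc (0 : ℝ) T,
      HasDerivAt (iteratedDeriv k f) (iteratedDeriv (k + 1) f x) x := by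
    intro k hk x _
    have hdiff : Differentiable ℝ (iteratedDeriv k f) :=
      hf.differentiable_iteratedDeriv k (by exact_mod_cast (by omega : k < D + 2))
    rw [iteratedDeriv_succ]
    exact (hdiff x).hasDerivAt
  have := h.abs_levelSum_add_le_of_hasDerivAt (fun k => iteratedDeriv k f) hK0 hder hbd
  simpa [iteratedDeriv_zero] using this

/-- Power form of the `C^{D+2}` corollary: `|Σ_c w_c f(c) + f(0)| ≤ B · T^{D+1}/(D+1)! · K`; with
`K = M (D+1)!/ρ^{D+1}` (a profile analytic with radius `ρ`, Cauchy's estimate) this reads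
`≤ B · M · (T/ρ)^{D+1}`. [cite: Agarwal2000DifferenceEquations, Remark 1.8.1 (1.8.8)]
[cite: Rivlin1974, Sect. 1.3 (1.32)–(1.34)] -/
theorem abs_levelSum_add_le_of_contDiff_pow (h : IsExactDesign n t T D B C w) (f : ℝ → ℝ)
    (hf : ContDiff ℝ (D + 2) f) {K : ℝ} (hK0 : 0 ≤ K)
    (hbd : ∀ x ∈ Set.Icc (0 : ℝ) T, |iteratedDeriv (D + 1) f x| ≤ K) :
    |∑ c ∈ C, w c * f c + f 0| ≤ B * ((T : ℝ) ^ (D + 1) / ((D + 1).factorial : ℝ)) * K := by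
  have hB0 : 0 ≤ B := (sum_nonneg fun c _ => abs_nonneg (w c)).trans h.variation_le
  refine (h.abs_levelSum_add_le_of_contDiff f hf hK0 hbd).trans ?_
  have hc : ((T.choose (D + 1) : ℕ) : ℝ) ≤ (T : ℝ) ^ (D + 1) / ((D + 1).factorial : ℝ) := by
    have := Nat.choose_le_pow_div (D + 1) T (α := ℝ)
    simpa using this
  exact mul_le_mul_of_nonneg_right (mul_le_mul_of_nonneg_left hc hB0) hK0

end IsExactDesign

/-! ### §5 Odd levels: the step-2 reindexing

The level classes of a `t`-cut (`t` odd) are non-empty only at odd levels `c = 2j + 1`, so a level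
profile is sampled on the step-2 lattice and its natural differences are `Δ_{(2)}`. Newton's formula
with step `2` and base level `1` is Agarwal's (1.8.6) for `ψ(j) := φ(2j+1)`; the corresponding real
polynomial is `N_D ψ((X − 1)/2)`, and its value at the virtual level `0` is the design's target. -/

namespace DesignRemainder

/-- The step-2 Newton polynomial of an odd-level profile: `N^{odd}_D φ = N_D ψ ((X − 1)/2)` with
`ψ(j) = φ(2j+1)`. [cite: Agarwal2000DifferenceEquations, Thm. 1.8.5 (1.8.6) (step h = 2, base a = 1)] -/
def newtonPolyOdd (D : ℕ) (φ : ℕ → ℝ) : ℝ[X] :=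
  (newtonPoly D fun j => φ (2 * j + 1)).comp (C (1 / 2 : ℝ) * (X - C 1))

/-- At an odd level `2j+1` the step-2 Newton polynomial is the Newton polynomial of `ψ` at `j`.
[cite: Agarwal2000DifferenceEquations, Thm. 1.8.5 (1.8.6)] -/
theorem newtonPolyOdd_eval_odd (D : ℕ) (φ : ℕ → ℝ) (j : ℕ) :
    (newtonPolyOdd D φ).eval (((2 * j + 1 : ℕ) : ℝ)) = (newtonPoly D fun j => φ (2 * j + 1)).eval (j : ℝ) := by
  rw [newtonPolyOdd, eval_comp]
  congr 1
  simp only [eval_mul, eval_C, eval_sub, eval_X]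
  push_cast
  ring

/-- `deg N^{odd}_D φ ≤ D`. [cite: Agarwal2000DifferenceEquations, Remark 1.8.1] -/
theorem natDegree_newtonPolyOdd_le (D : ℕ) (φ : ℕ → ℝ) : (newtonPolyOdd D φ).natDegree ≤ D := by
  rw [newtonPolyOdd]
  refine natDegree_comp_le.trans ?_
  have h1 : (C (1 / 2 : ℝ) * (X - C 1)).natDegree ≤ 1 :=
    (natDegree_C_mul_le _ _).trans ((natDegree_sub_le _ _).trans (by simp))
  calc (newtonPoly D fun j => φ (2 * j + 1)).natDegree * (C (1 / 2 : ℝ) * (X - C 1)).natDegree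
      ≤ D * 1 := Nat.mul_le_mul (natDegree_newtonPoly_le D _) h1
    _ = D := mul_one D

/-- At the odd levels the step-2 Newton remainder is Agarwal's remainder of `ψ`:
`φ(2j+1) − N^{odd}_D φ(2j+1) = R_D(j)ψ`. [cite: Agarwal2000DifferenceEquations, Thm. 1.8.5 (1.8.6)] -/
theorem sub_newtonPolyOdd_eval (D : ℕ) (φ : ℕ → ℝ) (j : ℕ) :
    φ (2 * j + 1) - (newtonPolyOdd D φ).eval (((2 * j + 1 : ℕ) : ℝ)) =
      newtonRem D j (fun j => φ (2 * j + 1)) := by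
  rw [newtonPolyOdd_eval_odd]
  exact sub_newtonPoly_eval D j (fun j => φ (2 * j + 1))

end DesignRemainder

/-- **Design error at odd levels by step-2 differences**: for a rule exact at `0` in degree `≤ D`
whose nodes are ODD and `≤ T`, with `Σ_c |w_c| ≤ B`, and a profile whose step-2 differences
`Δ^{D+1}ψ` (`ψ(j) = φ(2j+1)`) are `≤ K` for `2(j+D+1)+1 ≤ T`:
`|Σ_c w_c φ(c) + N^{odd}_D φ(0)| ≤ B · C((T−1)/2, D+1) · K` — the virtual value is the extrapolated
one (Lebesgue form with `p = N^{odd}_D φ`, `η₀ = 0`).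
[cite: Agarwal2000DifferenceEquations, Remark 1.8.1 (1.8.8)] [cite: Rivlin1974, Sect. 1.3 (1.32)–(1.34)] -/
theorem abs_levelSum_add_le_of_exact_of_fwdDiff_odd {C : Finset ℕ} {w : ℕ → ℝ} {D : ℕ}
    (hex : ∀ p : ℝ[X], p.natDegree ≤ D → ∑ c ∈ C, w c * p.eval (c : ℝ) = -p.eval 0)
    {B : ℝ} (hB : ∑ c ∈ C, |w c| ≤ B) {T : ℕ} (hT : ∀ c ∈ C, c ≤ T) (hodd : ∀ c ∈ C, Odd c)
    (φ : ℕ → ℝ) {K : ℝ} (hK0 : 0 ≤ K)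
    (hK : ∀ j : ℕ, 2 * (j + D + 1) + 1 ≤ T →
      |((fwdDiff (1 : ℕ))^[D + 1] (fun j => φ (2 * j + 1))) j| ≤ K) :
    |∑ c ∈ C, w c * φ c + (DesignRemainder.newtonPolyOdd D φ).eval 0| ≤
      B * ((((T - 1) / 2).choose (D + 1) : ℕ) : ℝ) * K := by
  set q := DesignRemainder.newtonPolyOdd D φ with hq
  set φ' : ℕ → ℝ := Function.update φ 0 (q.eval 0) with hφ'
  have h0 : ∀ c ∈ C, c ≠ 0 := fun c hc h => by
    have := hodd c hc; rw [h] at this; exact (Nat.not_odd_iff_even.2 (by decide)) this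
  have hsum : ∑ c ∈ C, w c * φ c + q.eval 0 = ∑ c ∈ C, w c * φ' c + φ' 0 := by
    rw [hφ', Function.update_self]
    congr 1
    exact sum_congr rfl fun c hc => by rw [Function.update_of_ne (h0 c hc)]
  rw [hsum]
  have hη : ∀ c ∈ C, |φ' c - q.eval (c : ℝ)| ≤ ((((T - 1) / 2).choose (D + 1) : ℕ) : ℝ) * K := by
    intro c hc
    obtain ⟨j, hj⟩ := hodd c hc
    rw [hφ', Function.update_of_ne (h0 c hc), hj, hq,
      show ((2 * j + 1 : ℕ) : ℝ) = (((2 * j + 1 : ℕ) : ℕ) : ℝ) from rfl,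
      DesignRemainder.sub_newtonPolyOdd_eval]
    have hjT : j ≤ (T - 1) / 2 := by
      have := hT c hc; rw [hj] at this; omega
    calc |DesignRemainder.newtonRem D j (fun j => φ (2 * j + 1))|
        ≤ ((j.choose (D + 1) : ℕ) : ℝ) * K :=
          DesignRemainder.abs_newtonRem_le D j _ fun j' hj' => hK j' (by
            have := hT c hc; rw [hj] at this; omega)
      _ ≤ ((((T - 1) / 2).choose (D + 1) : ℕ) : ℝ) * K :=
          mul_le_mul_of_nonneg_right (Nat.cast_le.2 (Nat.choose_le_choose _ hjT)) hK0
  have hη₀ : |φ' 0 - q.eval 0| ≤ 0 := by rw [hφ', Function.update_self, sub_self, abs_zero]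
  have := abs_levelSum_add_le_of_exact_of_poly hex hB φ' (DesignRemainder.natDegree_newtonPolyOdd_le D φ)
    hη hη₀
  linarith

/-- The same for an exact design `IsExactDesign n t T D B C w` (its levels are odd and `≤ T`).
[cite: Agarwal2000DifferenceEquations, Remark 1.8.1 (1.8.8)] [cite: Rivlin1974, Sect. 1.3 (1.32)–(1.34)] -/
theorem IsExactDesign.abs_levelSum_add_le_of_fwdDiff_odd {n t T D : ℕ} {B : ℝ} {C : Finset ℕ}
    {w : ℕ → ℝ} (h : IsExactDesign n t T D B C w) (φ : ℕ → ℝ) {K : ℝ} (hK0 : 0 ≤ K)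
    (hK : ∀ j : ℕ, 2 * (j + D + 1) + 1 ≤ T →
      |((fwdDiff (1 : ℕ))^[D + 1] (fun j => φ (2 * j + 1))) j| ≤ K) :
    |∑ c ∈ C, w c * φ c + (DesignRemainder.newtonPolyOdd D φ).eval 0| ≤
      B * ((((T - 1) / 2).choose (D + 1) : ℕ) : ℝ) * K :=
  abs_levelSum_add_le_of_exact_of_fwdDiff_odd h.exact h.variation_le h.level_le
    (fun c hc => (h.2.2.2.1 c hc).1) φ hK0 hK

/-! ### §6 The exact Newton expansion of the design error (odd levels)

Newton's formula WITHOUT truncation (Mathlib `shift_eq_sum_fwdDiff_iter`; Mariconda–Tonolo,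
*Discrete Calculus*, Thm 6.53) separates design and profile completely: with the design's NEWTON
MOMENTS `m_k = Σ_c w_c C((c−1)/2, k)` and the profile's Newton coefficients `Δ^kψ(0)` at the base
level `c = 1`, `Σ_c w_c φ(c) = Σ_k m_k Δ^kψ(0)`, exactness gives `m_k = −C(−1/2, k)` for `k ≤ D`, hence
`Σ_c w_c φ(c) + N^{odd}_D φ(0) = Σ_{D < k ≤ N} m_k Δ^kψ(0)` EXACTLY (`N ≥ (T−1)/2`): the design error
is the pairing of the design's moments beyond degree `D` with the profile's higher Newton
coefficients at the base. -/

namespace DesignRemainder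

/-- The step-2 binomial polynomial `C((X−1)/2, k)`. [cite: Agarwal2000DifferenceEquations, Thm. 1.8.5 (1.8.6)] -/
def chooseXOdd (k : ℕ) : ℝ[X] := (chooseX k).comp (C (1 / 2 : ℝ) * (X - C 1))

/-- At an odd level, `C((2j+1−1)/2, k) = C(j,k)`. [cite: Agarwal2000DifferenceEquations, Thm. 1.8.5 (1.8.6)] -/
theorem chooseXOdd_eval_odd (k j : ℕ) : (chooseXOdd k).eval (((2 * j + 1 : ℕ) : ℝ)) = ((j.choose k : ℕ) : ℝ) := by
  rw [chooseXOdd, eval_comp, ← chooseX_eval_natCast k j]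
  congr 1
  simp only [eval_mul, eval_C, eval_sub, eval_X]
  push_cast
  ring

/-- `deg C((X−1)/2, k) ≤ k`. [cite: Agarwal2000DifferenceEquations, Thm. 1.8.5 (1.8.6)] -/
theorem natDegree_chooseXOdd_le (k : ℕ) : (chooseXOdd k).natDegree ≤ k := by
  rw [chooseXOdd]
  refine natDegree_comp_le.trans ?_
  have h1 : (C (1 / 2 : ℝ) * (X - C 1)).natDegree ≤ 1 :=
    (natDegree_C_mul_le _ _).trans ((natDegree_sub_le _ _).trans (by simp))
  calc (chooseX k).natDegree * (C (1 / 2 : ℝ) * (X - C 1)).natDegree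
      ≤ k * 1 := Nat.mul_le_mul (natDegree_chooseX_le k) h1
    _ = k := mul_one k

/-- The step-2 Newton polynomial in the binomial basis: `N^{odd}_D φ = Σ_{k ≤ D} Δ^kψ(0) · C((X−1)/2, k)`.
[cite: Agarwal2000DifferenceEquations, Thm. 1.8.5 (1.8.6)] -/
theorem newtonPolyOdd_eq_sum (D : ℕ) (φ : ℕ → ℝ) :
    newtonPolyOdd D φ = ∑ k ∈ range (D + 1),
      C (((fwdDiff (1 : ℕ))^[k] (fun j => φ (2 * j + 1))) 0) * chooseXOdd k := by
  rw [newtonPolyOdd, newtonPoly, Polynomial.sum_comp]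
  exact sum_congr rfl fun k _ => by rw [mul_comp, C_comp, chooseXOdd]

/-- **The design's Newton moments** (odd levels): `m_k = Σ_c w_c · C((c−1)/2, k)`.
[cite: Rivlin1974, Sect. 1.3 (1.32)–(1.34)] -/
def newtonMomentOdd (C : Finset ℕ) (w : ℕ → ℝ) (k : ℕ) : ℝ := ∑ c ∈ C, w c * (chooseXOdd k).eval (c : ℝ)

/-- **Newton expansion of the level sum** (no truncation): for odd nodes `≤ 2N+1`,
`Σ_c w_c φ(c) = Σ_{k ≤ N} m_k · Δ^kψ(0)`, `ψ(j) = φ(2j+1)`.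
[cite: Agarwal2000DifferenceEquations, Thm. 1.8.5 (1.8.6) with n > k − a (Newton's formula)] -/
theorem levelSum_eq_sum_newtonMomentOdd {C : Finset ℕ} (w : ℕ → ℝ) (hodd : ∀ c ∈ C, Odd c) {N : ℕ}
    (hN : ∀ c ∈ C, c ≤ 2 * N + 1) (φ : ℕ → ℝ) :
    ∑ c ∈ C, w c * φ c = ∑ k ∈ range (N + 1),
      newtonMomentOdd C w k * ((fwdDiff (1 : ℕ))^[k] (fun j => φ (2 * j + 1))) 0 := by
  set ψ : ℕ → ℝ := fun j => φ (2 * j + 1) with hψ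
  -- Newton's formula for each node
  have hnode : ∀ c ∈ C, φ c = ∑ k ∈ range (N + 1),
      (chooseXOdd k).eval (c : ℝ) * ((fwdDiff (1 : ℕ))^[k] ψ) 0 := by
    intro c hc
    obtain ⟨j, hj⟩ := hodd c hc
    have hjN : j ≤ N := by have := hN c hc; omega
    have hnewton := shift_eq_sum_fwdDiff_iter (h := (1 : ℕ)) ψ j 0
    simp only [zero_add, smul_eq_mul, nsmul_eq_mul, mul_one] at hnewton
    rw [hj, show φ (2 * j + 1) = ψ j from rfl, show ψ j = ψ (j : ℕ) from rfl]
    rw [hnewton, ← sum_range_add_sum_Ico _ (by omega : j + 1 ≤ N + 1)]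
    rw [sum_eq_zero (s := Ico (j + 1) (N + 1)) fun k hk => by
      rw [show ((2 * j + 1 : ℕ) : ℝ) = (((2 * j + 1 : ℕ) : ℕ) : ℝ) from rfl, chooseXOdd_eval_odd,
        Nat.choose_eq_zero_of_lt (by have := (mem_Ico.1 hk).1; omega), Nat.cast_zero, zero_mul], add_zero]
    exact sum_congr rfl fun k _ => by
      rw [show ((2 * j + 1 : ℕ) : ℝ) = (((2 * j + 1 : ℕ) : ℕ) : ℝ) from rfl, chooseXOdd_eval_odd]
  calc ∑ c ∈ C, w c * φ c
      = ∑ c ∈ C, ∑ k ∈ range (N + 1), w c * ((chooseXOdd k).eval (c : ℝ) * ((fwdDiff (1 : ℕ))^[k] ψ) 0) := by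
        refine sum_congr rfl fun c hc => ?_
        rw [hnode c hc, mul_sum]
    _ = ∑ k ∈ range (N + 1), ∑ c ∈ C, w c * ((chooseXOdd k).eval (c : ℝ) * ((fwdDiff (1 : ℕ))^[k] ψ) 0) :=
        sum_comm
    _ = ∑ k ∈ range (N + 1), newtonMomentOdd C w k * ((fwdDiff (1 : ℕ))^[k] ψ) 0 := by
        refine sum_congr rfl fun k _ => ?_
        rw [newtonMomentOdd, sum_mul]
        exact sum_congr rfl fun c _ => by ring

/-- Exactness in the Newton basis: `m_k = −C(−1/2, k)` (`= −C((X−1)/2,k)(0)`) for `k ≤ D`.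
[cite: Rivlin1974, Sect. 1.3 (1.32)–(1.34)] -/
theorem newtonMomentOdd_eq_of_le {C : Finset ℕ} {w : ℕ → ℝ} {D : ℕ}
    (hex : ∀ p : ℝ[X], p.natDegree ≤ D → ∑ c ∈ C, w c * p.eval (c : ℝ) = -p.eval 0) {k : ℕ} (hk : k ≤ D) :
    newtonMomentOdd C w k = -(chooseXOdd k).eval 0 :=
  hex _ ((natDegree_chooseXOdd_le k).trans hk)

end DesignRemainder

/-- **Exact Newton form of the design error (odd levels)**: for a rule exact at `0` in degree `≤ D`
with odd nodes `≤ 2N+1` (`D ≤ N`),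
`Σ_c w_c φ(c) + N^{odd}_D φ(0) = Σ_{k=D+1}^{N} m_k · Δ^kψ(0)` — the design's Newton moments beyond
degree `D` paired with the profile's Newton coefficients at the base level.
[cite: Agarwal2000DifferenceEquations, Thm. 1.8.5 (1.8.6)] [cite: Rivlin1974, Sect. 1.3 (1.32)–(1.34)] -/
theorem levelSum_add_eq_sum_Ico_newtonMomentOdd {C : Finset ℕ} {w : ℕ → ℝ} {D : ℕ}
    (hex : ∀ p : ℝ[X], p.natDegree ≤ D → ∑ c ∈ C, w c * p.eval (c : ℝ) = -p.eval 0)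
    (hodd : ∀ c ∈ C, Odd c) {N : ℕ} (hN : ∀ c ∈ C, c ≤ 2 * N + 1) (hDN : D ≤ N) (φ : ℕ → ℝ) :
    ∑ c ∈ C, w c * φ c + (DesignRemainder.newtonPolyOdd D φ).eval 0 =
      ∑ k ∈ Ico (D + 1) (N + 1), DesignRemainder.newtonMomentOdd C w k *
        ((fwdDiff (1 : ℕ))^[k] (fun j => φ (2 * j + 1))) 0 := by
  rw [DesignRemainder.levelSum_eq_sum_newtonMomentOdd w hodd hN φ,
    ← sum_range_add_sum_Ico _ (by omega : D + 1 ≤ N + 1), DesignRemainder.newtonPolyOdd_eq_sum,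
    eval_finsetSum]
  have hhead : ∑ k ∈ range (D + 1), DesignRemainder.newtonMomentOdd C w k *
      ((fwdDiff (1 : ℕ))^[k] (fun j => φ (2 * j + 1))) 0 +
      ∑ k ∈ range (D + 1), (Polynomial.C (((fwdDiff (1 : ℕ))^[k] (fun j => φ (2 * j + 1))) 0) *
        DesignRemainder.chooseXOdd k).eval 0 = 0 := by
    rw [← sum_add_distrib]
    refine sum_eq_zero fun k hk => ?_
    rw [DesignRemainder.newtonMomentOdd_eq_of_le hex (Nat.lt_succ_iff.1 (mem_range.1 hk)), eval_mul, eval_C]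
    ring
  linarith

/-- Hence `|Σ_c w_c φ(c) + N^{odd}_D φ(0)| ≤ Σ_{k=D+1}^{N} |m_k| · |Δ^kψ(0)|`, and `|m_k| ≤ B · C(N, k)`
(`|C(j,k)| ≤ C(N,k)` on the nodes): only the profile's Newton coefficients AT THE BASE LEVEL enter.
[cite: Agarwal2000DifferenceEquations, Remark 1.8.1] [cite: Rivlin1974, Sect. 1.3 (1.32)–(1.34)] -/
theorem abs_newtonMomentOdd_le {C : Finset ℕ} {w : ℕ → ℝ} (hodd : ∀ c ∈ C, Odd c) {N : ℕ}
    (hN : ∀ c ∈ C, c ≤ 2 * N + 1) {B : ℝ} (hB : ∑ c ∈ C, |w c| ≤ B) (k : ℕ) :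
    |DesignRemainder.newtonMomentOdd C w k| ≤ B * ((N.choose k : ℕ) : ℝ) := by
  rw [DesignRemainder.newtonMomentOdd]
  calc |∑ c ∈ C, w c * (DesignRemainder.chooseXOdd k).eval (c : ℝ)|
      ≤ ∑ c ∈ C, |w c * (DesignRemainder.chooseXOdd k).eval (c : ℝ)| := abs_sum_le_sum_abs _ _
    _ ≤ ∑ c ∈ C, |w c| * ((N.choose k : ℕ) : ℝ) := sum_le_sum fun c hc => by
        obtain ⟨j, hj⟩ := hodd c hc
        have hjN : j ≤ N := by have := hN c hc; omega
        rw [abs_mul, hj, show ((2 * j + 1 : ℕ) : ℝ) = (((2 * j + 1 : ℕ) : ℕ) : ℝ) from rfl,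
          DesignRemainder.chooseXOdd_eval_odd, Nat.abs_cast]
        exact mul_le_mul_of_nonneg_left (Nat.cast_le.2 (Nat.choose_le_choose _ hjN)) (abs_nonneg _)
    _ = (∑ c ∈ C, |w c|) * ((N.choose k : ℕ) : ℝ) := by rw [sum_mul]
    _ ≤ B * ((N.choose k : ℕ) : ℝ) := mul_le_mul_of_nonneg_right hB (Nat.cast_nonneg _)

end Literature.Combinatorics.Optimization

end
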